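import Summits.AtomisticToContinuum.Crystallization.Theses.FreeSplittingCertificates
import Literature.Barriers.PneNP.TSPExtensionComplexityFarkas
import Literature.MathematicalPhysics.StatisticalMechanics.LennardJonesClusters
import Literature.MathematicalPhysics.StatisticalMechanics.LennardJonesThermodynamicLimitProofs

/-!
# Route `FreeSplittingCertificates`, support item `FreePairSplitting`
# (stmt-AtomisticToContinuum-12563)

"Certificates are free": for every `N` and every injective configuration `x : Fin N → ℝ³` there
are bond weights `w i j ≥ 0` with `w i j + w j i = 1` (`i ≠ j`) such that every weighted site
energy `∑_{j ≠ i} w i j · V_LJ(|x i − x j|)` is at least Fekete's constant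
`e_∞ = ⨅_M E(M+1)/(M+1)`.

PROOF (finite LP duality — Gale's supply–demand theorem / Hoffman's circulation theorem — here
through the tree's conic Farkas lemma `Literature.Barriers.PneNP.farkas`).

* `FreePair.layerCake` — for a real matrix `V` on `Fin N` and a level `e` satisfying the CUT
  INEQUALITY `#S · 2e ≤ ∑_{i,j ∈ S} V i j` for every index set `S`, one has, for every `γ ≥ 0`,
  `(∑ γ_i) · 2e ≤ ∑_{i,j} min(γ_i, γ_j) V i j` (peel the minimum of `γ` off its support; induction
  on the size of the support — the discrete layer-cake / Lovász-extension argument).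
* `FreePair.exists_splitting_of_cut` — for symmetric `V` with the cut inequality there are
  `w ≥ 0`, `w i j + w j i = 1`, with `e ≤ ∑_j w i j V i j` at every `i`: Farkas on the system
  `{w_p + w_{p̄} = 1 (p an ordered pair), ∑_j w_(k,j) V k j − s_k = e (k a site), w, s ≥ 0}`; the
  primal branch is the claim, and a dual ray `(β, −γ)` would satisfy `γ ≥ 0`,
  `β_p + β_{p̄} ≥ γ_{p.1} V_p` (hence, by symmetry, `≥ min(γ_{p.1}, γ_{p.2}) V_p`) and
  `∑ β < e ∑ γ`, contradicting `layerCake`.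
* `freePairSplitting_proof` — for Lennard-Jones and injective `x` the cut inequality is
  `2 E(#S) ≤ ∑_{i,k ∈ S} V_LJ(|x_i − x_k|)` (`two_mul_groundStateEnergy_card_le`; diagonal terms
  are `V_LJ(0) = 0`) together with `e_∞ ≤ E(n)/n` (`ciInf_le`; the sequence is bounded below by
  stability, `neg_mul_le_groundStateEnergy_lennardJones`).

Sources: D. Gale, *A theorem on flows in networks*, Pacific J. Math. 7 (1957), Thm 1;
Bondy–Murty GTM 244 (2008) Thm 20.9; Blanc–Lewin 2015 §1.3 (8). Everything below is a [folklore]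
consequence of landed tree theorems.
-/

noncomputable section

open Finset

namespace Summit.AtomisticToContinuum.Crystallization.Theorems

open Literature.MathematicalPhysics.StatisticalMechanics
open Summit.AtomisticToContinuum.Crystallization.Theses.FreeSplittingCertificates (FreePairSplitting)

namespace FreePair

/-- **Discrete layer cake.** If `#S · 2e ≤ ∑_{i ∈ S} ∑_{j ∈ S} V i j` for every index set `S`,
then for every `γ ≥ 0` whose support has at most `n` elements,
`(∑ᵢ γᵢ) · 2e ≤ ∑ᵢ ∑ⱼ min(γᵢ, γⱼ) · V i j`. Induction on `n`: subtract the minimum `m > 0` of `γ`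
on its support `S` (times the indicator of `S`); `min(γᵢ, γⱼ)` drops by exactly `m · 1_S(i) 1_S(j)`,
`∑ γ` by `m · #S`, and the difference is the cut inequality for `S` times `m`. [folklore] -/
theorem layerCake {N : ℕ} (V : Fin N → Fin N → ℝ) (e : ℝ)
    (hcut : ∀ S : Finset (Fin N), (S.card : ℝ) * (2 * e) ≤ ∑ i ∈ S, ∑ j ∈ S, V i j) :
    ∀ (n : ℕ) (γ : Fin N → ℝ), (∀ i, 0 ≤ γ i) → (univ.filter fun i => 0 < γ i).card ≤ n →
      (∑ i, γ i) * (2 * e) ≤ ∑ i, ∑ j, min (γ i) (γ j) * V i j := by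
  intro n
  induction n with
  | zero =>
    intro γ hγ hcard
    have h0 : ∀ i, γ i = 0 := by
      intro i
      rw [Nat.le_zero, Finset.card_eq_zero] at hcard
      have hi : i ∉ univ.filter fun i => 0 < γ i := by simp [hcard]
      have : ¬ 0 < γ i := by simpa using hi
      exact le_antisymm (not_lt.1 this) (hγ i)
    simp [h0]
  | succ n ih =>
    intro γ hγ hcard
    set S : Finset (Fin N) := univ.filter fun i => 0 < γ i with hS
    have hχS : ∀ i, i ∈ S ↔ 0 < γ i := fun i => by simp [hS]
    rcases S.eq_empty_or_nonempty with hSe | hSne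
    · have h0 : ∀ i, γ i = 0 := by
        intro i
        have hi : ¬ 0 < γ i := fun h => by simpa [hSe] using (hχS i).2 h
        exact le_antisymm (not_lt.1 hi) (hγ i)
      simp [h0]
    · obtain ⟨i₀, hi₀S, hmin⟩ := S.exists_min_image γ hSne
      set m : ℝ := γ i₀ with hm
      have hm0 : 0 < m := (hχS i₀).1 hi₀S
      -- indicator of the support and the peeled function
      set χ : Fin N → ℝ := fun i => if 0 < γ i then 1 else 0 with hχ
      set γ' : Fin N → ℝ := fun i => γ i - m * χ i with hγ'
      have hγ0_of_not : ∀ i, ¬ 0 < γ i → γ i = 0 := fun i hi =>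
        le_antisymm (not_lt.1 hi) (hγ i)
      have hγ'_of_pos : ∀ i, 0 < γ i → γ' i = γ i - m := fun i hi => by
        simp [hγ', hχ, hi]
      have hγ'_of_not : ∀ i, ¬ 0 < γ i → γ' i = 0 := fun i hi => by
        simp [hγ', hχ, hγ0_of_not i hi]
      have hγ'nn : ∀ i, 0 ≤ γ' i := by
        intro i
        by_cases hi : 0 < γ i
        · rw [hγ'_of_pos i hi]
          have := hmin i ((hχS i).2 hi)
          linarith
        · rw [hγ'_of_not i hi]
      -- the support of `γ'` lies in `S.erase i₀`
      have hsupp : (univ.filter fun i => 0 < γ' i) ⊆ S.erase i₀ := by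
        intro i hi
        simp only [Finset.mem_filter, Finset.mem_univ, true_and] at hi
        refine Finset.mem_erase.2 ⟨?_, (hχS i).2 ?_⟩
        · rintro rfl
          rw [hγ'_of_pos _ hm0, ← hm, sub_self] at hi
          exact lt_irrefl _ hi
        · by_contra h
          rw [hγ'_of_not i h] at hi
          exact lt_irrefl _ hi
      have hcard' : (univ.filter fun i => 0 < γ' i).card ≤ n := by
        have h1 := Finset.card_le_card hsupp
        rw [Finset.card_erase_of_mem hi₀S] at h1
        omega
      have IH := ih γ' hγ'nn hcard'
      -- `∑ γ = ∑ γ' + m · #S`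
      have hsumχ : ∑ i, χ i = S.card := by
        rw [hS]
        simp only [hχ]
        rw [Finset.sum_boole]
      have hsumγ : ∑ i, γ i = ∑ i, γ' i + m * S.card := by
        rw [← hsumχ, Finset.mul_sum, ← Finset.sum_add_distrib]
        exact Finset.sum_congr rfl fun i _ => by simp only [hγ']; ring
      -- `min(γ i, γ j) = min(γ' i, γ' j) + m · χ i χ j`
      have hmin_dec : ∀ i j, min (γ i) (γ j) = min (γ' i) (γ' j) + m * (χ i * χ j) := by
        intro i j
        by_cases hi : 0 < γ i
        · by_cases hj : 0 < γ j
          · rw [hγ'_of_pos i hi, hγ'_of_pos j hj, min_sub_sub_right]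
            simp [hχ, hi, hj]
          · rw [hγ0_of_not j hj, hγ'_of_not j hj, min_eq_right (hγ i), min_eq_right (hγ'nn i)]
            simp [hχ, hj]
        · rw [hγ0_of_not i hi, hγ'_of_not i hi, min_eq_left (hγ j), min_eq_left (hγ'nn j)]
          simp [hχ, hi]
      -- the correction term is the double sum over `S × S`
      have hVS : ∑ i, ∑ j, χ i * χ j * V i j = ∑ i ∈ S, ∑ j ∈ S, V i j := by
        rw [hS, Finset.sum_filter]
        refine Finset.sum_congr rfl fun i _ => ?_
        rw [Finset.sum_filter]
        by_cases hi : 0 < γ i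
        · rw [if_pos hi]
          refine Finset.sum_congr rfl fun j _ => ?_
          by_cases hj : 0 < γ j
          · simp [hχ, hi, hj]
          · simp [hχ, hj]
        · rw [if_neg hi]
          refine Finset.sum_eq_zero fun j _ => ?_
          simp [hχ, hi]
      have hrhs : ∑ i, ∑ j, min (γ i) (γ j) * V i j =
          ∑ i, ∑ j, min (γ' i) (γ' j) * V i j + m * ∑ i ∈ S, ∑ j ∈ S, V i j := by
        rw [← hVS, Finset.mul_sum, ← Finset.sum_add_distrib]
        refine Finset.sum_congr rfl fun i _ => ?_
        rw [Finset.mul_sum, ← Finset.sum_add_distrib]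
        refine Finset.sum_congr rfl fun j _ => ?_
        rw [hmin_dec]
        ring
      have hmS : m * ((S.card : ℝ) * (2 * e)) ≤ m * ∑ i ∈ S, ∑ j ∈ S, V i j :=
        mul_le_mul_of_nonneg_left (hcut S) hm0.le
      rw [hsumγ, hrhs]
      linarith [IH, hmS]

/-- **Splitting weights from the cut inequality** (finite LP duality). For a symmetric matrix
`V` on `Fin N` and a level `e` with `#S · 2e ≤ ∑_{i ∈ S} ∑_{j ∈ S} V i j` for all `S`, there are
weights `w ≥ 0` with `w i j + w j i = 1` and `e ≤ ∑ⱼ w i j · V i j` at every site `i`. Conic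
Farkas (`Literature.Barriers.PneNP.farkas`) on the columns `w_p` (`p` an ordered pair) and site
slacks `s_k`, rows "`w_p + w_{p̄} = 1`" and "`∑ⱼ w_(k,j) V k j − s_k = e`": the primal branch is
the claim; a dual vector `(β, −γ)` has `γ ≥ 0`, `β_(i,j) + β_(j,i) ≥ γ_i V i j` — so, by symmetry,
`≥ min(γ_i, γ_j) V i j` — and `∑ β < e ∑ γ`, against `layerCake`. (Gale 1957, Thm 1 /
Bondy–Murty Thm 20.9, specialised.) [folklore] -/
theorem exists_splitting_of_cut {N : ℕ} (V : Fin N → Fin N → ℝ) (hsymm : ∀ i j, V i j = V j i)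
    (e : ℝ) (hcut : ∀ S : Finset (Fin N), (S.card : ℝ) * (2 * e) ≤ ∑ i ∈ S, ∑ j ∈ S, V i j) :
    ∃ w : Fin N → Fin N → ℝ, (∀ i j, 0 ≤ w i j) ∧ (∀ i j, w i j + w j i = 1) ∧
      ∀ i, e ≤ ∑ j, w i j * V i j := by
  classical
  -- columns: pair variables `w_p` and site slacks `s_m`; rows: pair rows `q`, site rows `k`
  let a : (Fin N × Fin N) ⊕ Fin N → (Fin N × Fin N) ⊕ Fin N → ℝ :=
    Sum.elim
      (fun p => Sum.elim (fun q => (if p = q then 1 else 0) + (if p.swap = q then 1 else 0))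
        (fun k => if k = p.1 then V p.1 p.2 else 0))
      (fun m => Sum.elim (fun _ => 0) (fun k => if k = m then -1 else 0))
  let b : (Fin N × Fin N) ⊕ Fin N → ℝ := Sum.elim (fun _ => 1) (fun _ => e)
  -- a row computation used in both branches
  have hrow : ∀ (k : Fin N) (f : Fin N × Fin N → ℝ),
      ∑ p : Fin N × Fin N, (if k = p.1 then f p else 0) = ∑ j, f (k, j) := by
    intro k f
    rw [Fintype.sum_prod_type, Finset.sum_comm]
    simp only [Finset.sum_ite_eq, Finset.mem_univ, if_true]
  rcases Literature.Barriers.PneNP.farkas a b with ⟨lam, hlam, hb⟩ | ⟨y, hy, hby⟩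
  · refine ⟨fun i j => lam (Sum.inl (i, j)), fun i j => hlam _, fun i j => ?_, fun i => ?_⟩
    · -- pair row `(i, j)`: `1 = w i j + w j i`
      have h := hb (Sum.inl (i, j))
      simp only [a, b, Sum.elim_inl, Fintype.sum_sum_type, Sum.elim_inr, mul_zero,
        Finset.sum_const_zero, add_zero, mul_add, mul_ite, mul_one, Finset.sum_add_distrib,
        Finset.sum_ite_eq', Finset.mem_univ, if_true, Prod.swap_eq_iff_eq_swap,
        Prod.swap_prod_mk] at h
      linarith
    · -- site row `i`: `e = ∑ⱼ w i j V i j − s_i`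
      have h := hb (Sum.inr i)
      simp only [a, b, Sum.elim_inl, Sum.elim_inr, Fintype.sum_sum_type, mul_ite, mul_zero,
        mul_neg, mul_one, Finset.sum_ite_eq, Finset.mem_univ, if_true] at h
      have h' : ∑ p : Fin N × Fin N, (if i = p.1 then lam (Sum.inl p) * V p.1 p.2 else 0) =
          ∑ j, lam (Sum.inl (i, j)) * V i j := hrow i fun p => lam (Sum.inl p) * V p.1 p.2
      rw [h'] at h
      have := hlam (Sum.inr i)
      linarith
  · -- the dual ray is impossible
    exfalso
    set β : Fin N × Fin N → ℝ := fun q => y (Sum.inl q) with hβ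
    set γ : Fin N → ℝ := fun k => -y (Sum.inr k) with hγ
    have hγnn : ∀ k, 0 ≤ γ k := by
      intro k
      have h := hy (Sum.inr k)
      simp only [a, dotProduct, Fintype.sum_sum_type, Sum.elim_inr, Sum.elim_inl, zero_mul,
        Finset.sum_const_zero, zero_add, ite_mul, neg_mul, one_mul, Finset.sum_ite_eq',
        Finset.mem_univ, if_true] at h
      simpa [hγ] using h
    have hpair : ∀ i j, γ i * V i j ≤ β (i, j) + β (j, i) := by
      intro i j
      have h := hy (Sum.inl (i, j))
      simp only [a, dotProduct, Fintype.sum_sum_type, Sum.elim_inl, Sum.elim_inr, add_mul,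
        ite_mul, one_mul, zero_mul, Finset.sum_add_distrib, Finset.sum_ite_eq, Finset.sum_ite_eq',
        Finset.mem_univ, if_true, Prod.swap_prod_mk] at h
      simp only [hβ, hγ]
      linarith
    have hobj : ∑ q, β q < e * ∑ k, γ k := by
      have h := hby
      simp only [b, dotProduct, Fintype.sum_sum_type, Sum.elim_inl, Sum.elim_inr, one_mul] at h
      simp only [hβ, hγ, Finset.sum_neg_distrib, mul_neg]
      rw [← Finset.mul_sum] at h
      linarith
    have hmin : ∀ i j, min (γ i) (γ j) * V i j ≤ β (i, j) + β (j, i) := by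
      intro i j
      rcases min_choice (γ i) (γ j) with h | h <;> rw [h]
      · exact hpair i j
      · rw [hsymm, add_comm]
        exact hpair j i
    have hsum : ∑ i, ∑ j, min (γ i) (γ j) * V i j ≤ 2 * ∑ q, β q := by
      calc ∑ i, ∑ j, min (γ i) (γ j) * V i j ≤ ∑ i, ∑ j, (β (i, j) + β (j, i)) :=
            Finset.sum_le_sum fun i _ => Finset.sum_le_sum fun j _ => hmin i j
        _ = ∑ q, β q + ∑ q, β q := by
            rw [Finset.sum_congr rfl fun i _ => Finset.sum_add_distrib, Finset.sum_add_distrib,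
              ← Fintype.sum_prod_type, ← Fintype.sum_prod_type_right]
        _ = 2 * ∑ q, β q := by ring
    have hlc := layerCake V e hcut _ γ hγnn le_rfl
    linarith

end FreePair

/-- **`FreePairSplitting` holds** (item stmt-AtomisticToContinuum-12563 of route
`FreeSplittingCertificates`): for every `N` and every injective `x : Fin N → ℝ³` there are
weights `w i j ≥ 0`, `w i j + w j i = 1` (`i ≠ j`), with
`⨅_M E(M+1)/(M+1) ≤ ∑_{j ≠ i} w i j · V_LJ(|x i − x j|)` at every site `i`. The cut inequality
of `FreePair.exists_splitting_of_cut` for `V i j = V_LJ(|x i − x j|)` is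
`#S · 2e_∞ ≤ 2 E(#S) ≤ ∑_{i,k ∈ S} V_LJ(|x_i − x_k|)` (`ciInf_le` with the stability bound, and
`two_mul_groundStateEnergy_card_le`); the diagonal terms vanish since `V_LJ(0) = 0`. [folklore] -/
theorem freePairSplitting_proof : FreePairSplitting := by
  intro N x hx
  classical
  set e : ℝ := ⨅ M : ℕ, groundStateEnergy lennardJones 3 (M + 1) / ((M + 1 : ℕ) : ℝ) with he
  -- `e ≤ E(M+1)/(M+1)`: the defining sequence is bounded below (stability)
  have hbdd : BddBelow (Set.range fun M : ℕ =>
      groundStateEnergy lennardJones 3 (M + 1) / ((M + 1 : ℕ) : ℝ)) := by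
    refine ⟨-(65536 ^ 2 / 12 : ℝ), ?_⟩
    rintro _ ⟨M, rfl⟩
    have hpos : (0 : ℝ) < ((M + 1 : ℕ) : ℝ) := by positivity
    rw [le_div_iff₀ hpos, neg_mul]
    exact neg_mul_le_groundStateEnergy_lennardJones (d := 3) (by norm_num) (M + 1)
  have hle : ∀ M : ℕ, ((M + 1 : ℕ) : ℝ) * e ≤ groundStateEnergy lennardJones 3 (M + 1) := by
    intro M
    have h1 : e ≤ groundStateEnergy lennardJones 3 (M + 1) / ((M + 1 : ℕ) : ℝ) :=
      ciInf_le hbdd M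
    have hpos : (0 : ℝ) < ((M + 1 : ℕ) : ℝ) := by positivity
    rw [le_div_iff₀ hpos] at h1
    linarith
  -- the bond matrix and its cut inequality
  set V : Fin N → Fin N → ℝ := fun i j => lennardJones (dist (x i) (x j)) with hV
  have hsymm : ∀ i j, V i j = V j i := fun i j => by simp [hV, dist_comm]
  have hcut : ∀ S : Finset (Fin N), (S.card : ℝ) * (2 * e) ≤ ∑ i ∈ S, ∑ j ∈ S, V i j := by
    intro S
    have h2 := two_mul_groundStateEnergy_card_le lennardJones lennardJones_zero
      neg_one_div_le_lennardJones hx S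
    rcases Nat.eq_zero_or_pos S.card with h0 | hpos
    · rw [Finset.card_eq_zero.1 h0]
      simp
    · obtain ⟨k, hk⟩ := Nat.exists_eq_succ_of_ne_zero hpos.ne'
      have hk' := hle k
      have hkc : ((k + 1 : ℕ) : ℝ) = (S.card : ℝ) := by rw [hk]
      rw [hkc] at hk'
      have hEk : groundStateEnergy lennardJones 3 (k + 1) = groundStateEnergy lennardJones 3 S.card := by
        rw [hk]
      rw [hEk] at hk'
      calc (S.card : ℝ) * (2 * e) = 2 * ((S.card : ℝ) * e) := by ring
        _ ≤ 2 * groundStateEnergy lennardJones 3 S.card := by linarith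
        _ ≤ ∑ i ∈ S, ∑ j ∈ S, V i j := h2
  obtain ⟨w, hw0, hw1, hwe⟩ := FreePair.exists_splitting_of_cut V hsymm e hcut
  refine ⟨w, fun i j _ => ⟨hw0 i j, hw1 i j⟩, fun i => ?_⟩
  have hdiag : w i i * lennardJones (dist (x i) (x i)) = 0 := by
    rw [dist_self, lennardJones_zero, mul_zero]
  rw [Finset.sum_erase (f := fun j => w i j * lennardJones (dist (x i) (x j))) univ hdiag]
  exact hwe i

end Summit.AtomisticToContinuum.Crystallization.Theorems

end
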